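import Summits.QuantumFields.YangMills.Theorems.LuscherReductionTwistedTraceScalingMultiScaleEntropyWrapping
import HarnessLib

/-!
# `TwistedTraceScaling` (stmt-QuantumFields-20203, route `LuscherReduction`, open stub `stub_cmpTwoLoop` ≡ LIM): prover-side support, part 3 —
# EVERY SUBLINEAR ACTION COST IS BELOW THE ENTROPY THRESHOLD: Bałaban-type small-field violations (cost `≍ p(g)² = polylog(β)`) are ABUNDANT at the cutoff
# scale of the femto window, so no supplier may exclude them globally

HONEST FRAMING: `--supports` helper for the OPEN crux `TwistedTraceScaling` (femto rung R2b1 of the CONDITIONAL reduction route `LuscherReduction`); elementary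
real analysis on the tree's window labels (parts 1–2: ✓`…MultiScaleEntropy`, ✓`…MultiScaleEntropyWrapping`; negative-side source ✓`Negative.R80`).  It proves
nothing about Yang–Mills measures, closes no stub, and is not a mass-gap or Clay statement.  No definition, no `Theses` import, no `sorry`.

R80 showed: a cutoff-scale event of FIXED bare cost `δ < 1/b₀` (tree weight `e^{−δβ}`) is entropically dominant on `W(lam, L)` (`L⁴e^{−δβ} → ∞`), in particular
every per-plaquette event (`δ ≤ 4`).  Bałaban's small-field condition at the cutoff, `|F| < g₀·p(g₀)` with `p(g) = (log g⁻²)^{p₀}`-type thresholds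
([Balaban1989LargeFieldII], [Balaban1987RG1 (0.31)]), is violated at bare cost `≍ β·g₀²p(g₀)² = p(g₀)²`, i.e. a POLYLOGARITHM of `β` — not a fixed `δ`, but
still `o(β)`.  THIS FILE: ★ `subLinearCost_abundant` — for ANY cost function `κ : ℝ → ℝ` with `κ(β) ≤ θβ` eventually for every `θ > 0` (sublinear in the
inverse bare coupling), `L⁴e^{−κ(β)}` is unbounded along the window (all large `L`, every window point); instances: `c·(log β)^n` for every `c ≥ 0`, `n : ℕ`
(`polylogCost_sublinear`, `polylogCost_abundant`), and the femto 4-volume form `L³·T_s·e^{−κ(β)}` (`subLinearCost_abundant_femto`).  With part 1 §1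
(`x(1) = x(L) + 2b₀ log L ≤ 1/lam³ + 2b₀ log L`) the same holds for costs sublinear in the RUNNING cutoff label `x(1)`.

READING (constraint on proofs of CMP-2LOOP ∕ LIM; refutes nothing): Bałaban's large fields — at the cutoff and, by part 1 §3, a fortiori in any union over
scales containing it — occur SOMEWHERE in the femto universe with overwhelming weight on the scaling window, uniformly badly in `L`; an `L`-uniform supplier
must carry them as LOCAL polymer activities (small per block), never as a globally excluded event.  Global exclusion is available only above the
scale-invariant threshold `2/b₀` running units per block (part 1 §4) and for time-wrapping polymers (part 2 §7).
-/

set_option autoImplicit false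

noncomputable section

open MeasureTheory Filter Topology Real
open Literature.MathematicalPhysics.QuantumFieldTheory hiding SU2
open Literature.MathematicalPhysics.QuantumLattice
open Literature.Analysis.OperatorTheory.YMMatrixModel
open scoped BigOperators

namespace Summit.QuantumFields.YangMills.Theorems.FemtoTransferGap.MultiScaleEntropy

open Summit.QuantumFields.YangMills.Theorems.FemtoTransferGap
open Summit.QuantumFields.YangMills.Theorems.FemtoTransferGap.TraceDoor
open Summit.QuantumFields.YangMills.Theorems.TwistedTraceScaling.Negative

/-! ## §8 Sublinear costs are abundant at the cutoff scale of the window -/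

/-- ★★ **Every sublinear action cost is below the entropy threshold.**  Let `κ : ℝ → ℝ` satisfy: for every `θ > 0` there is `β₀` with `κ β ≤ θ·β` for all
`β ≥ β₀`.  Then for every depth `lam > 0` and every `M`, `M ≤ L⁴ e^{−κ(β)}` at every point of `W(lam, L)` for all large `L` (take `θ = 1/(2b₀) < 1/b₀` in R80's
`fourVolume_defect_unbounded`; on the window `β > 4b₀ log L ≥ β₀` eventually). [folklore] -/
theorem subLinearCost_abundant {κ : ℝ → ℝ} (hκ : ∀ θ : ℝ, 0 < θ → ∃ β₀ : ℝ, ∀ β : ℝ, β₀ ≤ β → κ β ≤ θ * β)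
    {lam : ℝ} (hlam : 0 < lam) (M : ℝ) :
    ∃ L1 : ℕ, ∀ (L : ℕ) [NeZero L], L1 ≤ L → ∀ β : ℝ, InFemtoWindow lam β L →
      M ≤ (L : ℝ) ^ 4 * Real.exp (-(κ β)) := by
  have hb0 : 0 < b0 := by unfold b0; positivity
  have hθ : (0 : ℝ) < 1 / (2 * b0) := by positivity
  have hθlt : 1 / (2 * b0) < 1 / b0 := by
    rw [div_lt_div_iff₀ (by positivity) hb0]; nlinarith
  obtain ⟨β₀, hβ₀⟩ := hκ (1 / (2 * b0)) hθ
  obtain ⟨L1, hL1⟩ := R80.fourVolume_defect_unbounded hθlt hlam M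
  -- make `4b₀ log L ≥ β₀` for `L ≥ L2`
  refine ⟨max L1 ⌈Real.exp (β₀ / (4 * b0))⌉₊, fun L _ hL β hW => ?_⟩
  have hLpos : (0 : ℝ) < L := by exact_mod_cast Nat.pos_of_ne_zero (NeZero.ne L)
  have h1 := hL1 L ((le_max_left _ _).trans hL) β hW
  have hL2 : Real.exp (β₀ / (4 * b0)) ≤ (L : ℝ) := (Nat.le_ceil _).trans (by exact_mod_cast (le_max_right _ _).trans hL)
  have hlogL : β₀ / (4 * b0) ≤ Real.log (L : ℝ) := by
    rw [Real.le_log_iff_exp_le hLpos]; exact hL2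
  have hβ : 4 * b0 * Real.log L < β := four_b0_log_lt_beta_of_window hlam hW
  have hβ₀β : β₀ ≤ β := by
    rw [div_le_iff₀ (by positivity)] at hlogL
    nlinarith
  have hk := hβ₀ β hβ₀β
  have hexp : Real.exp (-(1 / (2 * b0) * β)) ≤ Real.exp (-(κ β)) := by
    rw [Real.exp_le_exp]; linarith
  exact h1.trans (mul_le_mul_of_nonneg_left hexp (by positivity))

/-- **Femto 4-volume form**: under the same hypothesis, for `s > 0`, `M ≤ L³ · T_s · e^{−κ(β)}` on `W(lam, L)` for all large `L` (`T_s ≥ sL/(2lam)`). [folklore] -/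
theorem subLinearCost_abundant_femto {κ : ℝ → ℝ} (hκ : ∀ θ : ℝ, 0 < θ → ∃ β₀ : ℝ, ∀ β : ℝ, β₀ ≤ β → κ β ≤ θ * β)
    {s lam : ℝ} (hs : 0 < s) (hlam : 0 < lam) (M : ℝ) :
    ∃ L1 : ℕ, ∀ (L : ℕ) [NeZero L], L1 ≤ L → ∀ β : ℝ, InFemtoWindow lam β L →
      M ≤ (L : ℝ) ^ 3 * (femtoSteps s β L : ℝ) * Real.exp (-(κ β)) := by
  obtain ⟨L1, hL1⟩ := subLinearCost_abundant hκ hlam (max M 0 * (2 * lam / s))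
  refine ⟨L1, fun L _ hL β hW => ?_⟩
  have h := hL1 L hL β hW
  have hT := R80.femtoSteps_ge_of_window hs.le hlam hW
  have h1 : (L : ℝ) ^ 3 * (s * L / (2 * lam)) * Real.exp (-(κ β))
      ≤ (L : ℝ) ^ 3 * (femtoSteps s β L : ℝ) * Real.exp (-(κ β)) :=
    mul_le_mul_of_nonneg_right (mul_le_mul_of_nonneg_left hT (by positivity)) (Real.exp_pos _).le
  have h2 : (L : ℝ) ^ 3 * (s * L / (2 * lam)) * Real.exp (-(κ β)) = (s / (2 * lam)) * ((L : ℝ) ^ 4 * Real.exp (-(κ β))) := by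
    ring
  have h3 : (s / (2 * lam)) * (max M 0 * (2 * lam / s)) = max M 0 := by
    field_simp
  have h4 : (s / (2 * lam)) * (max M 0 * (2 * lam / s)) ≤ (s / (2 * lam)) * ((L : ℝ) ^ 4 * Real.exp (-(κ β))) :=
    mul_le_mul_of_nonneg_left h (by positivity)
  calc M ≤ max M 0 := le_max_left _ _
    _ = _ := h3.symm
    _ ≤ _ := h4
    _ = _ := h2.symm
    _ ≤ _ := h1

/-! ## §9 Instance: polylogarithmic costs (Bałaban's `p(g)² = (log g⁻²)^{2p₀}`-type thresholds) -/

/-- **Polylogarithmic costs are sublinear**: for `c ≥ 0` and `n : ℕ`, for every `θ > 0` eventually `c·(log β)^n ≤ θβ` (`(log β)^n = o(β)`,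
Mathlib `Real.isLittleO_pow_log_id_atTop`). [folklore] -/
theorem polylogCost_sublinear {c : ℝ} (hc : 0 ≤ c) (n : ℕ) :
    ∀ θ : ℝ, 0 < θ → ∃ β₀ : ℝ, ∀ β : ℝ, β₀ ≤ β → c * Real.log β ^ n ≤ θ * β := by
  intro θ hθ
  rcases hc.eq_or_lt with h0 | hcpos
  · refine ⟨0, fun β hβ => ?_⟩
    rw [← h0, zero_mul]; positivity
  have hlo := (Real.isLittleO_pow_log_id_atTop (n := n)).def (show 0 < θ / c by positivity)
  rw [Filter.eventually_atTop] at hlo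
  obtain ⟨β₀, hβ₀⟩ := hlo
  refine ⟨max β₀ 1, fun β hβ => ?_⟩
  have hβ1 : 1 ≤ β := (le_max_right _ _).trans hβ
  have h := hβ₀ β ((le_max_left _ _).trans hβ)
  simp only [id, Real.norm_eq_abs] at h
  have hlog : 0 ≤ Real.log β := Real.log_nonneg hβ1
  rw [abs_of_nonneg (pow_nonneg hlog n), abs_of_nonneg (by linarith : (0 : ℝ) ≤ β)] at h
  have h2 : c * Real.log β ^ n ≤ c * (θ / c * β) := mul_le_mul_of_nonneg_left h hc
  have h3 : c * (θ / c * β) = θ * β := by field_simp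
  linarith

/-- ★ **Bałaban-type small-field violations are abundant at the cutoff scale of the window**: for every `c ≥ 0`, `n : ℕ`, depth `lam > 0` and `M`,
`M ≤ L⁴ e^{−c (log β)^n}` at every point of `W(lam, L)` for all large `L`. [folklore] -/
theorem polylogCost_abundant {c : ℝ} (hc : 0 ≤ c) (n : ℕ) {lam : ℝ} (hlam : 0 < lam) (M : ℝ) :
    ∃ L1 : ℕ, ∀ (L : ℕ) [NeZero L], L1 ≤ L → ∀ β : ℝ, InFemtoWindow lam β L →
      M ≤ (L : ℝ) ^ 4 * Real.exp (-(c * Real.log β ^ n)) :=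
  subLinearCost_abundant (κ := fun β => c * Real.log β ^ n) (polylogCost_sublinear hc n) hlam M

/-- … and in the femto 4-volume form `L³ · T_s · e^{−c(log β)^n}`. [folklore] -/
theorem polylogCost_abundant_femto {c : ℝ} (hc : 0 ≤ c) (n : ℕ) {s lam : ℝ} (hs : 0 < s) (hlam : 0 < lam) (M : ℝ) :
    ∃ L1 : ℕ, ∀ (L : ℕ) [NeZero L], L1 ≤ L → ∀ β : ℝ, InFemtoWindow lam β L →
      M ≤ (L : ℝ) ^ 3 * (femtoSteps s β L : ℝ) * Real.exp (-(c * Real.log β ^ n)) :=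
  subLinearCost_abundant_femto (κ := fun β => c * Real.log β ^ n) (polylogCost_sublinear hc n) hs hlam M

/-! ## §10 The running cutoff label is itself `O(log L)` on the window (so «sublinear in `x(1)`» ⟹ «sublinear in `log L`» too) -/

/-- On `W(lam, L)` the running inverse coupling at the CUTOFF scale obeys `2b₀ log L ≤ x(1) ≤ 1/lam³ + 2b₀ log L` (part 1 §1 with `ℓ = 1` and the window's
`0 < x(L) ≤ 1/lam³`). [cite: LuscherMunster1984, §2] -/
theorem cutoffLabel_window_bounds {lam β : ℝ} {L : ℕ} [NeZero L] (hlam : 0 < lam) (hW : InFemtoWindow lam β L) :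
    2 * b0 * Real.log L ≤ invRunningCoupling β 1 ∧ invRunningCoupling β 1 ≤ 1 / lam ^ 3 + 2 * b0 * Real.log L := by
  have hL : 0 < L := Nat.pos_of_ne_zero (NeZero.ne L)
  have hsc := invRunningCoupling_scale β Nat.one_pos hL
  simp only [Nat.cast_one, div_one] at hsc
  have hx := invRunningCoupling_le_of_window hlam hW
  constructor <;> linarith [hx.1, hx.2]

end Summit.QuantumFields.YangMills.Theorems.FemtoTransferGap.MultiScaleEntropy

end
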